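import Summits.Parity.GeneralizedHardyLittlewood.Theorems.LeeYangFibresRelativeDimOneNecessityDefs
import Summits.Parity.GeneralizedHardyLittlewood.Theorems.LeeYangFibresRelativeDimOneAmplification
import Summits.Parity.GeneralizedHardyLittlewood.Theorems.LeeYangFibresRelativeDimOneSingularMeanGlue
import Summits.Parity.GeneralizedHardyLittlewood.Theorems.LeeYangFibresRelativeDimOneLocalAverage
import Summits.Parity.GeneralizedHardyLittlewood.Theorems.LeeYangFibresRelativeDimOneSingularTail
import Summits.Parity.GeneralizedHardyLittlewood.Theorems.LeeYangFibresRelativeDimOneDegenerateCount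
import Summits.Parity.GeneralizedHardyLittlewood.Theorems.LeeYangFibresRelativeDimOneArchFacts
import HarnessLib

/-!
# Route `LeeYangFibres`, crux `RelativeDimOne` (stmt-Parity-14113), line `SketchIdeator1` =
`translate-amplification`, cycle 2 (card `gallagher-backwards-split`): certificate U —
UPPER-HALF AMPLIFICATION `upperRelativeDimOne_of_coarseUpperHLSlack`

The registered sub-goal `upperRelativeDimOne_of_coarseUpperHLSlack : CoarseUpperHLSlack → UpperRelativeDimOne`:
coarse UPPER bounds `S(Φ,K) ≤ e^{g(T)} β_∞𝔖 + ηN` for prime constellations, with ANY sub-exponential loss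
`g(T) = o(T)` in the number `T` of forms and `o(N)` slack, already give the SHARP upper bound
`S(Ψ,K) ≤ (1+ε) β_∞(Ψ,K) 𝔖(Ψ) + εN` of the crux. This is the upper half of the landed transfer
`stub_amplification` (`Theorems/LeeYangFibresRelativeDimOneAmplification.lean`), run with the upper
inequalities only; the other three inputs of the transfer are theorems (`completeSum`,
`stub_singularMeanGlue stub_localAverage stub_singularTail stub_degenerateCount stub_archFacts : SingularMean`,
`stub_degenerateCount`). Together with the necessity certificates `latticeNecessity` and
`characterNecessity` (their own files) it shows that the UPPER half of the atom `CoarseHLSlack` is already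
`UniformCharPNT`-hard.

Schedule (given `t ≥ 1`, `L`, `ε > 0`; `e = min ε 1`, `S = S(Ψ,K,N)`, `M = β_∞(Ψ,K) 𝔖(Ψ) ≥ 0`):

* `g(T)/T → 0` gives `m ≥ 1` with `|g((m+1)t)| ≤ (m+1) log(1 + e/4)`, so at dimension `T = (m+1)t`
  the loss is `e^{g(T)} ≤ A = (1+e/4)^{m+1}`.
* LOW MASS `M < κN`, `κ = e / (4 max(1, e^{g(t)}))`: the upper atom at dimension `t` with slack `e/4`
  gives `S ≤ e^{g(t)} M + eN/4 ≤ eN/2 ≤ (1+ε)M + εN`.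
* HIGH MASS `M ≥ κN`: `S^{m+1} = ∑_{H ∈ [-2N,2N]^m} S(Ψ^{(H)}, K_H)` (`completeSum`); on the
  non-degenerate shifts the upper atom at dimension `T` (size `‖Ψ^{(H)}‖_N ≤ (3m+1) max(L,1)`, convex
  `K_H ⊆ [-N,N]`) gives `S_H ≤ A M_H + η'N`, and `∑_{nondeg} M_H ≤ (1+ε₅) M^{m+1} + ε₅ N^{m+1}`
  (`SingularMean`); the `≤ C (4N+1)^{m-1}` degenerate shifts (`stub_degenerateCount`) carry
  `S_H ≤ (2N+1) log^T(2L'N)`, in total `o(N^{m+1})`. With `N^{m+1} ≤ M^{m+1}/κ^{m+1}` and `ε₅, η'`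
  small this is `S^{m+1} ≤ A(1 + e/10) M^{m+1} ≤ ((1+e/2)M)^{m+1}` (`upper_ratio`), whence
  `S ≤ (1 + e/2) M ≤ (1+ε)M + εN` by monotonicity of `x ↦ x^{m+1}` on `ℝ≥0`
  (`upper_high_mass_amplify` below does this bookkeeping; it is the upper half of
  `high_mass_amplify`).

References: Green–Tao, Ann. of Math. 171 (2010), Conj. 1.4 [GreenTao2010]; Gallagher, Mathematika 23
(1976) [Gallagher1976]; Tao–Vu, *Additive Combinatorics*, §2 (tensor power trick).
-/

noncomputable section

open scoped BigOperators Classical Topology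
open Finset Filter MeasureTheory Literature.NumberTheory.Sieve
open Summit.Parity.GeneralizedHardyLittlewood.Cruxes.RelativeDimOne.TranslateAmplification

namespace Summit.Parity.GeneralizedHardyLittlewood.Cruxes.RelativeDimOne.GallagherBackwards

/-! ### The tensor-power bookkeeping at high singular mass, upper half -/

/-- HIGH SINGULAR MASS, UPPER HALF (`k N^{m+1} ≤ M^{m+1}`, i.e. `κ N ≤ M` with `k = κ^{m+1}`). Over a
finite set `s` of shifts split into good (`p`) and bad ones: if `∑_s S_H = S^{m+1}` (complete sum),
`|∑_{good} M_H - M^{m+1}| ≤ ε₅ (M^{m+1} + N^{m+1})` (averaged main terms), `S_H ≤ A M_H + η' N` on good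
shifts (coarse UPPER bounds only, `A ≥ 1`), `S_H ≤ B` with `#bad · B ≤ CD · B ≤ ε₅ N^{m+1}` (few bad
shifts), `#s ≤ 5^m N^m`, and the parameters are `ε₅ = e k/40`, `η' = e k/(40 A 5^m)` with
`A(1 + e/10) ≤ (1+e/2)^{m+1}`, then `S^{m+1} ≤ ((1+e/2)M)^{m+1}`, whence `S ≤ (1 + e/2) M` by
monotonicity of `x ↦ x^{m+1}` on `ℝ≥0` (the upper half of `high_mass_amplify`). -/
theorem upper_high_mass_amplify {ι : Type*} (s : Finset ι) (p : ι → Prop) [DecidablePred p]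
    (SH MH : ι → ℝ) (m : ℕ) {N : ℕ} {S M A e k ε₅ η' CD B : ℝ}
    (hA : 1 ≤ A) (he0 : 0 ≤ e) (hS : 0 ≤ S) (hM : 0 ≤ M)
    (hk1 : k ≤ 1) (hkM : k * (N : ℝ) ^ (m + 1) ≤ M ^ (m + 1))
    (hε₅ : ε₅ = e * k / 40) (hη' : η' = e * k / (40 * A * 5 ^ m))
    (hX : ∑ H ∈ s, SH H = S ^ (m + 1))
    (hSig : |∑ H ∈ s.filter p, MH H - M ^ (m + 1)| ≤ ε₅ * (M ^ (m + 1) + (N : ℝ) ^ (m + 1)))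
    (hGup : ∀ H ∈ s, p H → SH H ≤ A * MH H + η' * N)
    (hDup : ∀ H ∈ s, ¬p H → SH H ≤ B) (hB : 0 ≤ B)
    (hη'0 : 0 ≤ η')
    (hcard : (s.card : ℝ) ≤ 5 ^ m * (N : ℝ) ^ m)
    (hcardD : ((s.filter (fun H => ¬p H)).card : ℝ) ≤ CD)
    (htail : CD * B ≤ ε₅ * (N : ℝ) ^ (m + 1))
    (hAup : A * (1 + e / 10) ≤ (1 + e / 2) ^ (m + 1)) :
    S ≤ (1 + e / 2) * M := by
  have hA0 : 0 < A := by linarith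
  have hP0 : 0 ≤ M ^ (m + 1) := pow_nonneg hM _
  -- the complete sum, split along `p`
  have hup := sum_filter_upper s p SH MH hGup hDup
  rw [hX] at hup
  have hcardG : ((s.filter p).card : ℝ) ≤ 5 ^ m * (N : ℝ) ^ m :=
    le_trans (by exact_mod_cast Finset.card_filter_le s p) hcard
  have hGslack : ((s.filter p).card : ℝ) * (η' * N) ≤ 5 ^ m * η' * (N : ℝ) ^ (m + 1) :=
    calc ((s.filter p).card : ℝ) * (η' * N) ≤ 5 ^ m * (N : ℝ) ^ m * (η' * N) :=
          mul_le_mul_of_nonneg_right hcardG (by positivity)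
      _ = 5 ^ m * η' * (N : ℝ) ^ (m + 1) := by rw [pow_succ]; ring
  have hDpart : ((s.filter (fun H => ¬p H)).card : ℝ) * B ≤ ε₅ * (N : ℝ) ^ (m + 1) :=
    (mul_le_mul_of_nonneg_right hcardD hB).trans htail
  have hXup : S ^ (m + 1) ≤
      A * ∑ H ∈ s.filter p, MH H + 5 ^ m * η' * (N : ℝ) ^ (m + 1) + ε₅ * (N : ℝ) ^ (m + 1) := by
    linarith
  -- the parameters against `k N^{m+1} ≤ M^{m+1}`
  have hθ : A * (5 ^ m * η' * (N : ℝ) ^ (m + 1)) ≤ e / 40 * M ^ (m + 1) := by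
    have h1 : A * (5 ^ m * η' * (N : ℝ) ^ (m + 1)) = e / 40 * (k * (N : ℝ) ^ (m + 1)) := by
      rw [hη']
      field_simp
    rw [h1]
    exact mul_le_mul_of_nonneg_left hkM (by positivity)
  have hε₅Q : ε₅ * (N : ℝ) ^ (m + 1) ≤ e / 40 * M ^ (m + 1) := by
    have h1 : ε₅ * (N : ℝ) ^ (m + 1) = e / 40 * (k * (N : ℝ) ^ (m + 1)) := by rw [hε₅]; ring
    rw [h1]
    exact mul_le_mul_of_nonneg_left hkM (by positivity)
  have hε₅P : ε₅ * M ^ (m + 1) ≤ e / 40 * M ^ (m + 1) := by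
    refine mul_le_mul_of_nonneg_right ?_ hP0
    rw [hε₅]
    have h1 : e * k ≤ e := by nlinarith
    linarith
  have hSigup := (abs_le.mp hSig).2
  have hSigup' : ∑ H ∈ s.filter p, MH H ≤ (1 + e / 20) * M ^ (m + 1) := by linarith
  -- `S^{m+1} ≤ A (1 + e/10) M^{m+1} ≤ ((1 + e/2) M)^{m+1}`
  have hAP : M ^ (m + 1) ≤ A * M ^ (m + 1) := le_mul_of_one_le_left hP0 hA
  have heAP : e / 40 * M ^ (m + 1) ≤ e / 40 * (A * M ^ (m + 1)) :=
    mul_le_mul_of_nonneg_left hAP (by positivity)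
  have hθQ : 5 ^ m * η' * (N : ℝ) ^ (m + 1) ≤ e / 40 * M ^ (m + 1) :=
    le_trans (le_mul_of_one_le_left (by positivity) hA) hθ
  have hASig : A * ∑ H ∈ s.filter p, MH H ≤ A * ((1 + e / 20) * M ^ (m + 1)) :=
    mul_le_mul_of_nonneg_left hSigup' hA0.le
  have hU : S ^ (m + 1) ≤ ((1 + e / 2) * M) ^ (m + 1) := by
    have h1 : S ^ (m + 1) ≤ A * (1 + e / 10) * M ^ (m + 1) := by linarith
    have h2 : A * (1 + e / 10) * M ^ (m + 1) ≤ (1 + e / 2) ^ (m + 1) * M ^ (m + 1) :=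
      mul_le_mul_of_nonneg_right hAup hP0
    rw [mul_pow]
    linarith
  -- `(m+1)`-th root
  exact (pow_le_pow_iff_left₀ hS (by positivity) (Nat.succ_ne_zero m)).mp hU

/-! ### Certificate U: upper-half amplification -/

/-- **CERTIFICATE U** (registered sub-goal of stmt-Parity-14113, card `gallagher-backwards-split`): the
UPPER half `CoarseUpperHLSlack` of the atom — coarse upper bounds `S ≤ e^{g(T)} β_∞𝔖 + ηN` with
sub-exponential loss `g(T) = o(T)` in the number of forms — already implies the sharp UPPER half
`UpperRelativeDimOne` of the crux, `S ≤ (1+ε) β_∞𝔖 + εN`, by the tensor-power trick over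
translate-constellations run with upper inequalities only (see the module docstring for the schedule). -/
theorem upperRelativeDimOne_of_coarseUpperHLSlack : CoarseUpperHLSlack → UpperRelativeDimOne := by
  intro hCU
  obtain ⟨g, hg, hA⟩ := hCU
  intro t L ht ε hε
  -- `e = min ε 1`
  obtain ⟨e, he⟩ : ∃ e : ℝ, e = min ε 1 := ⟨_, rfl⟩
  have he0 : 0 < e := by rw [he]; exact lt_min hε one_pos
  have he1 : e ≤ 1 := by rw [he]; exact min_le_right _ _
  have heε : e ≤ ε := by rw [he]; exact min_le_left _ _
  -- the number `m` of translates, from `g(T)/T → 0`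
  have ht0 : (0 : ℝ) < t := by exact_mod_cast ht
  have ha0 : (0 : ℝ) < 1 + e / 4 := by positivity
  have hc : 0 < Real.log (1 + e / 4) / t := div_pos (Real.log_pos (by linarith)) ht0
  obtain ⟨M₀, hM₀⟩ := exists_abs_le_mul_of_tendsto_div hg hc
  obtain ⟨m, hmM, hm1⟩ : ∃ m : ℕ, M₀ ≤ m ∧ 1 ≤ m := ⟨max M₀ 1, le_max_left _ _, le_max_right _ _⟩
  have hT1 : 1 ≤ (m + 1) * t := le_trans ht (Nat.le_mul_of_pos_left t (Nat.succ_pos m))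
  obtain ⟨A, hAdef⟩ : ∃ A : ℝ, A = (1 + e / 4) ^ (m + 1) := ⟨_, rfl⟩
  have hA1 : 1 ≤ A := by rw [hAdef]; exact one_le_pow₀ (by linarith)
  have hgT : |g ((m + 1) * t)| ≤ ((m + 1 : ℕ) : ℝ) * Real.log (1 + e / 4) := by
    have h1 : M₀ ≤ (m + 1) * t :=
      le_trans hmM (le_trans (Nat.le_succ m) (Nat.le_mul_of_pos_right _ ht))
    calc |g ((m + 1) * t)| ≤ Real.log (1 + e / 4) / t * (((m + 1) * t : ℕ) : ℝ) := hM₀ _ h1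
      _ = ((m + 1 : ℕ) : ℝ) * Real.log (1 + e / 4) := by
          push_cast
          field_simp
  have hexpU := (exp_le_pow_of_abs_le ha0 hgT).1
  rw [← hAdef] at hexpU
  -- the mass threshold `κ` and `k = κ^{m+1}`
  obtain ⟨κ, hκ⟩ : ∃ κ : ℝ, κ = e / (4 * max 1 (Real.exp (g t))) := ⟨_, rfl⟩
  have hmax1 : (1 : ℝ) ≤ max 1 (Real.exp (g t)) := le_max_left _ _
  have hmax2 : Real.exp (g t) ≤ max 1 (Real.exp (g t)) := le_max_right _ _
  have hκ0 : 0 < κ := by rw [hκ]; positivity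
  have hκexp : Real.exp (g t) * κ ≤ e / 4 := by
    rw [hκ, mul_div_assoc', div_le_div_iff₀ (by positivity) (by norm_num)]
    nlinarith [he0.le, Real.exp_pos (g t)]
  obtain ⟨k, hk⟩ : ∃ k : ℝ, k = κ ^ (m + 1) := ⟨_, rfl⟩
  have hk0 : 0 < k := by rw [hk]; exact pow_pos hκ0 _
  have hκ1 : κ ≤ 1 := by
    rw [hκ, div_le_one (by positivity)]
    nlinarith
  have hk1 : k ≤ 1 := by rw [hk]; exact pow_le_one₀ hκ0.le hκ1
  -- the small parameters
  obtain ⟨ε₅, hε₅⟩ : ∃ ε₅ : ℝ, ε₅ = e * k / 40 := ⟨_, rfl⟩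
  have hε₅0 : 0 < ε₅ := by rw [hε₅]; positivity
  obtain ⟨η', hη'⟩ : ∃ η' : ℝ, η' = e * k / (40 * A * 5 ^ m) := ⟨_, rfl⟩
  have hη'0 : 0 < η' := by rw [hη']; positivity
  -- the size of the translate-constellations
  obtain ⟨L', hL'⟩ : ∃ L' : ℕ, L' = (3 * m + 1) * max L 1 := ⟨_, rfl⟩
  have hL'1 : (1 : ℝ) ≤ (L' : ℝ) := by
    have h1 : 1 ≤ L' := by
      rw [hL']
      exact le_trans (le_max_right L 1) (Nat.le_mul_of_pos_left _ (Nat.succ_pos _))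
    exact_mod_cast h1
  -- the degenerate count, the averaged main terms (theorems of the line) and the thresholds
  obtain ⟨C₀, hC₀⟩ := stub_degenerateCount m t
  have hC0 : 0 ≤ max C₀ 0 := le_max_right _ _
  have hSM : SingularMean :=
    stub_singularMeanGlue stub_localAverage stub_singularTail stub_degenerateCount stub_archFacts
  obtain ⟨N₂, hN₂⟩ := hA t L ht (e / 4) (by positivity)
  obtain ⟨N₃, hN₃⟩ := hSM m t L ht ε₅ hε₅0
  obtain ⟨N₁, hN₁⟩ := hA ((m + 1) * t) L' hT1 η' hη'0
  obtain ⟨N₄, hN₄⟩ := exists_degenerate_tail_le m ((m + 1) * t) hm1 hC0 hL'1 hε₅0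
  refine ⟨N₁ + N₂ + N₃ + N₄ + 1, fun N hN Ψ hΨ hL K hK hKN => ?_⟩
  have hNN₁ : N₁ ≤ N := by omega
  have hNN₂ : N₂ ≤ N := by omega
  have hNN₃ : N₃ ≤ N := by omega
  have hNN₄ : N₄ ≤ N := by omega
  have hN1 : 1 ≤ N := by omega
  have hN0 : (0 : ℝ) ≤ N := Nat.cast_nonneg N
  have hS0 : 0 ≤ vonMangoldtSum Ψ K N :=
    Theorems.LeeYangFibresRelativeDimOne.vonMangoldtSum_nonneg Ψ K N
  have hM0 : 0 ≤ archFactor Ψ K * singularProduct Ψ :=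
    mul_nonneg (archFactor_nonneg' Ψ K)
      (CellParityLaw.SectionAnnihilator.SingularRatio.singularProduct_nonneg hΨ)
  have heM : e * (archFactor Ψ K * singularProduct Ψ) ≤ ε * (archFactor Ψ K * singularProduct Ψ) :=
    mul_le_mul_of_nonneg_right heε hM0
  have heN : e * (N : ℝ) ≤ ε * N := mul_le_mul_of_nonneg_right heε hN0
  have heM0 : 0 ≤ e * (archFactor Ψ K * singularProduct Ψ) := mul_nonneg he0.le hM0
  have heN0 : 0 ≤ e * (N : ℝ) := mul_nonneg he0.le hN0
  have hεM0 : 0 ≤ ε * (archFactor Ψ K * singularProduct Ψ) := mul_nonneg hε.le hM0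
  have hεN0 : 0 ≤ ε * (N : ℝ) := mul_nonneg hε.le hN0
  rcases lt_or_ge (archFactor Ψ K * singularProduct Ψ) (κ * N) with hlow | hhigh
  · -- LOW MASS: the upper atom at dimension `t` with slack `e/4`
    have h := hN₂ N hNN₂ Ψ hΨ hL K hK hKN
    have h1 : Real.exp (g t) * (archFactor Ψ K * singularProduct Ψ) ≤ e / 4 * N :=
      calc Real.exp (g t) * (archFactor Ψ K * singularProduct Ψ)
          ≤ Real.exp (g t) * (κ * N) := mul_le_mul_of_nonneg_left hlow.le (Real.exp_pos _).le
        _ = Real.exp (g t) * κ * N := by ring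
        _ ≤ e / 4 * N := mul_le_mul_of_nonneg_right hκexp hN0
    linarith
  · -- HIGH MASS: the tensor-power trick, upper half
    have hsize : ∀ H ∈ shiftBox m N, affLinSize (translateFamily Ψ H) N ≤ (L' : ℝ) := by
      intro H hH
      have h2 : (L : ℝ) ≤ ((max L 1 : ℕ) : ℝ) := by exact_mod_cast le_max_left L 1
      calc affLinSize (translateFamily Ψ H) N ≤ (3 * m + 1) * (L : ℝ) :=
            affLinSize_translateFamily_le hN1 hL hH
        _ ≤ (3 * m + 1) * ((max L 1 : ℕ) : ℝ) := mul_le_mul_of_nonneg_left h2 (by positivity)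
        _ = (L' : ℝ) := by rw [hL']; push_cast; ring
    have hkM : k * (N : ℝ) ^ (m + 1) ≤ (archFactor Ψ K * singularProduct Ψ) ^ (m + 1) := by
      rw [hk, ← mul_pow]
      exact pow_le_pow_left₀ (by positivity) hhigh _
    have hB0 : 0 ≤ (2 * (N : ℝ) + 1) * Real.log (2 * (L' : ℝ) * N) ^ ((m + 1) * t) := by
      have hN1r : (1 : ℝ) ≤ N := by exact_mod_cast hN1
      exact mul_nonneg (by positivity) (pow_nonneg (Real.log_nonneg (by nlinarith)) _)
    have key := upper_high_mass_amplify (shiftBox m N)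
      (fun H => IsNondegenerateSystem (translateFamily Ψ H))
      (fun H => vonMangoldtSum (translateFamily Ψ H) (meetTranslates K H) N)
      (fun H => archFactor (translateFamily Ψ H) (meetTranslates K H) *
        singularProduct (translateFamily Ψ H))
      m hA1 he0.le hS0 hM0 hk1 hkM hε₅ hη' (completeSum m t N Ψ K hKN)
      (hN₃ N hNN₃ Ψ hΨ hL K hK hKN)
      (fun H hH hnd => by
        have h := hN₁ N hNN₁ (translateFamily Ψ H) hnd (hsize H hH) (meetTranslates K H)
          (convex_meetTranslates hK H) ((meetTranslates_subset K H).trans hKN)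
        have hMH : 0 ≤ archFactor (translateFamily Ψ H) (meetTranslates K H) *
            singularProduct (translateFamily Ψ H) :=
          mul_nonneg (archFactor_nonneg' _ _)
            (CellParityLaw.SectionAnnihilator.SingularRatio.singularProduct_nonneg hnd)
        have h2 := mul_le_mul_of_nonneg_right hexpU hMH
        show vonMangoldtSum (translateFamily Ψ H) (meetTranslates K H) N ≤
          A * (archFactor (translateFamily Ψ H) (meetTranslates K H) *
            singularProduct (translateFamily Ψ H)) + η' * N
        linarith)
      (fun H hH _ => vonMangoldtSum_le_card_mul hN1 hL'1 (hsize H hH) (meetTranslates K H))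
      hB0 hη'0.le
      (card_shiftBox_real_le m hN1)
      ((hC₀ N Ψ hΨ).trans (mul_le_mul_of_nonneg_right (le_max_left C₀ 0) (by positivity)))
      (hN₄ N hNN₄ hN1)
      (by rw [hAdef]; exact upper_ratio m e he0.le he1)
    -- `S ≤ (1 + e/2) M ≤ (1 + ε) M + ε N`
    linarith

end Summit.Parity.GeneralizedHardyLittlewood.Cruxes.RelativeDimOne.GallagherBackwards
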